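import Mathlib
import Literature.AlgebraicGeometry.Resolution.AdicQuotient
import HarnessLib

/-!
# `TeissierResolve`, line Sketch — stub `stub_toricTarget_powerSeries` (the formal power series
# ring is a completed simplicial toric ring: target side of the `g = 0` slice)

Crux `stmt-ResolutionOfSingularities-17086`
(`Summit.ResolutionOfSingularities.ResolutionOfSingularities.Theses.TeissierJung.TeissierResolve`),
line "toric normalisation + destackification". This file proves the plumbing stub
`stub_toricTarget_powerSeries` of the lead skeleton (`Cruxes/TeissierResolve/Lines/Sketch.lean`,
v6): the target ring of the `g = 0` slice of `toricNormalisation` (there the Teissier-presented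
domain is `k⟦x₁, …, x_d⟧` itself, already normal, and one has to exhibit it as a completed
simplicial toric ring).

## Informal statement

For a field `k` and `d ∈ ℕ` there are `d' ∈ ℕ`, a finite abelian group `A` and weights
`deg : {1, …, d'} → A` such that, grading `S = k[y₁, …, y_{d'}]` by `A` through `deg` (Mathlib's
`MvPolynomial.weightedHomogeneousSubmodule`, a `GradedAlgebra` via the local instance
`MvPolynomial.weightedGradedAlgebra`) with degree-`0` part `S₀ ⊆ S` (the simplicial toric ring
`k[σ^∨ ∩ M]`) and irrelevant ideal `𝔪₀ = ker (constantCoeff ∘ (S₀ ↪ S))`, the formal power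
series ring is the completed simplicial toric ring:
`k⟦x₁, …, x_d⟧ ≃+* (S₀)^_{𝔪₀} = AdicCompletion 𝔪₀ S₀`.
In words: affine `d`-space is the toric variety of the regular cone, so `k⟦x⟧` is (trivially) a
completed simplicial toric ring.

## Proof

Take `d' = d`, `A = Unit` the trivial group and `deg = 0`. Every monomial has weighted degree
`0 ∈ Unit`, so `S₀ = S = k[y₁, …, y_d]`: the inclusion `algebraMap S₀ S` is a bijective ring map,
whence a ring isomorphism `e : S₀ ≃ S`. It carries `𝔪₀ = e⁻¹(ker constantCoeff)` onto
`ker constantCoeff`, which is the ideal of the variables `(y₁, …, y_d) = idealOfVars` (a polynomial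
with vanishing constant term lies in the ideal of the variables: Mathlib's
`MvPolynomial.mem_pow_idealOfVars_iff'` with exponent `1`). Transport of adic completions along
ring isomorphisms (`adicCompletionCongr` of the tree, `AdicQuotient.lean`) gives
`AdicCompletion 𝔪₀ S₀ ≃+* AdicCompletion (y) k[y]`, and the `(y)`-adic completion of `k[y]` is
`k⟦y⟧` (Mathlib's `MvPowerSeries.toAdicCompletionAlgEquiv`).

Sources: M. F. Atiyah, I. G. Macdonald, *Introduction to Commutative Algebra* (1969), Ch. 10,
p. 106 (the `(x)`-adic completion of `A[x₁, …, xₙ]` is `A⟦x₁, …, xₙ⟧`); W. Fulton, *Introduction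
to Toric Varieties* (1993), §1.1 and §2.1–2.2 (affine space as the toric variety of the regular
cone; simplicial cones) for the terminology. No new definitions, no named facts. [folklore]
-/

noncomputable section

set_option linter.dupNamespace false -- mandated namespace of this single-conjunct summit

open Literature.AlgebraicGeometry.Resolution

namespace Summit.ResolutionOfSingularities.ResolutionOfSingularities.Theorems.TeissierResolve.ToricTargetPowerSeries

attribute [local instance] MvPolynomial.weightedGradedAlgebra

/-- The kernel of the augmentation `constantCoeff : R[yᵢ : i ∈ σ] → R` is the ideal of the
variables `(yᵢ : i ∈ σ) = idealOfVars σ R`. [folklore] -/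
theorem ker_constantCoeff_eq_idealOfVars (σ R : Type*) [CommRing R] :
    RingHom.ker (MvPolynomial.constantCoeff : MvPolynomial σ R →+* R) =
      MvPolynomial.idealOfVars σ R := by
  ext p
  rw [RingHom.mem_ker, ← pow_one (MvPolynomial.idealOfVars σ R),
    MvPolynomial.mem_pow_idealOfVars_iff', MvPolynomial.constantCoeff_eq]
  constructor
  · intro h x hx
    obtain rfl : x = 0 := (Finsupp.degree_eq_zero_iff x).mp (Nat.lt_one_iff.mp hx)
    exact h
  · intro h
    exact h 0 (by rw [map_zero]; exact Nat.one_pos)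

/-- For the trivial grading of `R[yᵢ : i ∈ σ]` (all weights `0 ∈ Unit`) every polynomial is
weighted homogeneous of degree `0`: the degree-`0` part is the whole polynomial ring. [folklore] -/
theorem mem_weightedHomogeneousSubmodule_unit (σ R : Type*) [CommRing R] (p : MvPolynomial σ R) :
    p ∈ MvPolynomial.weightedHomogeneousSubmodule R (fun _ : σ => (0 : Unit)) 0 :=
  (MvPolynomial.mem_weightedHomogeneousSubmodule R _ 0 p).mpr fun _ _ => Subsingleton.elim _ _

/-- For the trivial grading of `k[y₁, …, y_d]` (all weights `0 ∈ Unit`), the inclusion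
`algebraMap S₀ k[y]` of the degree-`0` part `S₀` is bijective. [folklore] -/
theorem algebraMap_gradeZero_unit_bijective (k : Type) [Field k] (d : ℕ) :
    Function.Bijective (algebraMap
      (MvPolynomial.weightedHomogeneousSubmodule k (fun _ : Fin d => (0 : Unit)) 0)
      (MvPolynomial (Fin d) k)) :=
  ⟨fun _ _ h => Subtype.ext h,
    fun p => ⟨⟨p, mem_weightedHomogeneousSubmodule_unit (Fin d) k p⟩, rfl⟩⟩

/-- The `g = 0` slice, target side, for the explicit trivial grading: with `S₀` the degree-`0`
part of `k[y₁, …, y_d]` graded by all weights `0 ∈ Unit` and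
`𝔪₀ = ker (constantCoeff ∘ (S₀ ↪ k[y]))`, `k⟦x₁, …, x_d⟧ ≃+* AdicCompletion 𝔪₀ S₀` (`S₀ = k[y]`
carries `𝔪₀` onto `(y₁, …, y_d)`, transport of completions `adicCompletionCongr`, and
`MvPowerSeries.toAdicCompletionAlgEquiv`). [folklore] -/
theorem nonempty_ringEquiv_adicCompletion_unit (k : Type) [Field k] (d : ℕ) :
    Nonempty (MvPowerSeries (Fin d) k ≃+*
      AdicCompletion
        (RingHom.ker (MvPolynomial.constantCoeff.comp
          (algebraMap (MvPolynomial.weightedHomogeneousSubmodule k (fun _ : Fin d => (0 : Unit)) 0)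
            (MvPolynomial (Fin d) k))))
        (MvPolynomial.weightedHomogeneousSubmodule k (fun _ : Fin d => (0 : Unit)) 0)) := by
  -- `S₀ = k[y]`: the inclusion of the degree-`0` part is a ring isomorphism `e`
  let e : MvPolynomial.weightedHomogeneousSubmodule k (fun _ : Fin d => (0 : Unit)) 0 ≃+*
      MvPolynomial (Fin d) k :=
    RingEquiv.ofBijective (algebraMap _ (MvPolynomial (Fin d) k))
      (algebraMap_gradeZero_unit_bijective k d)
  -- `e` carries the irrelevant ideal `𝔪₀ = e⁻¹(ker constantCoeff)` onto `(y₁, …, y_d)`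
  have he : Ideal.map e.toRingHom (RingHom.ker (MvPolynomial.constantCoeff.comp
      (algebraMap (MvPolynomial.weightedHomogeneousSubmodule k (fun _ : Fin d => (0 : Unit)) 0)
        (MvPolynomial (Fin d) k)))) = MvPolynomial.idealOfVars (Fin d) k := by
    have h : e.toRingHom = algebraMap _ (MvPolynomial (Fin d) k) := RingHom.ext fun _ => rfl
    rw [h, ← RingHom.comap_ker, Ideal.map_comap_of_surjective _
      (algebraMap_gradeZero_unit_bijective k d).surjective, ker_constantCoeff_eq_idealOfVars]
  -- `k⟦y⟧ ≃ k[y]^_{(y)} ≃ (S₀)^_{𝔪₀}`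
  exact ⟨(MvPowerSeries.toAdicCompletionAlgEquiv (Fin d) k).toRingEquiv.trans
    (adicCompletionCongr _ (MvPolynomial.idealOfVars (Fin d) k) e he).symm⟩

/-- **`k⟦x₁, …, x_d⟧` is a completed simplicial toric ring** (stub `stub_toricTarget_powerSeries`
of line Sketch of `TeissierResolve`: the target ring of the `g = 0` slice of toric
normalisation). For a field `k` and `d ∈ ℕ` there are `d'`, a finite abelian group `A` and weights
`deg : Fin d' → A` with `k⟦x₁, …, x_d⟧ ≃+* AdicCompletion 𝔪₀ S₀`, where `S₀` is the degree-`0`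
part of `k[y₁, …, y_{d'}]` graded through `deg` and `𝔪₀ = ker (constantCoeff ∘ (S₀ ↪ k[y]))` its
irrelevant ideal: take `d' = d`, `A = Unit`, `deg = 0`, so that `S₀ = k[y]`, `𝔪₀ = (y)` and
`AdicCompletion (y) k[y] = k⟦y⟧` (`MvPowerSeries.toAdicCompletionAlgEquiv`). [folklore] -/
theorem stub_toricTarget_powerSeries (k : Type) [Field k] (d : ℕ) :
    ∃ (d' : ℕ) (A : Type) (_ : AddCommGroup A) (_ : Finite A) (_ : DecidableEq A)
      (deg : Fin d' → A),
      Nonempty (MvPowerSeries (Fin d) k ≃+*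
        AdicCompletion
          (RingHom.ker (MvPolynomial.constantCoeff.comp
            (algebraMap (MvPolynomial.weightedHomogeneousSubmodule k deg 0)
              (MvPolynomial (Fin d') k))))
          (MvPolynomial.weightedHomogeneousSubmodule k deg 0)) := by
  exact ⟨d, Unit, inferInstance, inferInstance, inferInstance, fun _ => 0,
    nonempty_ringEquiv_adicCompletion_unit k d⟩

end Summit.ResolutionOfSingularities.ResolutionOfSingularities.Theorems.TeissierResolve.ToricTargetPowerSeries

end
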